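import Summits.BirchSwinnertonDyer.BirchSwinnertonDyer.Theorems.EisensteinDepletionAtTwoStarEisOddWitness
import Summits.BirchSwinnertonDyer.BirchSwinnertonDyer.Theorems.EisensteinDepletionAtTwoStarCuspValues
import HarnessLib

/-!
# Route `EisensteinDepletionAtTwo`, crux E1M `DepletedLambdaLawAtTwoMod` (item stmt-BirchSwinnertonDyer-20341),
# line `star` — the two CURRENCIES of the research stub (★-SymbC) are equivalent: primitive scales `(g, g')` mod 2
# ⟺ the scale-`8` congruence `([a/2ᵐ]⁺ − [1/2ᵐ]⁺)/g ≡ v(m,a)/8 (mod 2ℤ₂)`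

Cell `bsd-rank2` (HOME run/shared/lean/pub/bsd-rank2/), seat `bsd-rank2-star-p1` GEN 2 (lead of line `star`). THEOREMS ONLY — no
definition, no named fact, no `sorry`. HONEST FRAMING: statement hygiene for the ONE research stub of line `star`. The registered form
(★-SymbC) (`Cruxes/DepletedLambdaLawAtTwoMod/Lines/star.lean` v3.3, `SameOnCModTwo (plusCuspDiff f) (stabEisCuspDiff N β)`: some scales
`g, g' ≠ 0` make both sides integral on `C`, congruent mod `2`, with an odd value on the curve side) and eng-2 g8's scale-`8` form (★-SymbC′)
(`starCore_of_cuspCongruence8`, p563204: some `g ≠ 0` makes the curve side integral on `C` and `2`-adically congruent to `v/8`) are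
PROVED EQUIVALENT datum by datum (odd `N`, admissible `β`, any curve-side function `u`), using the two Eisenstein-side tree theorems
`starEisEight₂` (`‖v‖₂ ≤ 8⁻¹` on `C`, eng-2 g8) and `exists_inC_norm_stabEisCuspDiff_eq` (`‖v‖₂ = 8⁻¹` somewhere on `C`, lead GEN 2) and
the integrality `N·v ∈ ℤ`. So a future prover of the research stub may prove EITHER currency. Nothing here reads an analytic rank;
(★-SymbC)/(★)/E1M are NOT proved; BSD is not proved by any of this (PARTITION D-0054: none — r_an ≥ 2 axis S0, door T-r3₂).

* §1 `exists_int_natCast_mul_localStabCoeff`, `exists_int_natCast_pow_mul_localStabCoeff`, `exists_int_natCast_mul_stabCoeff`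
  (`N·c_t ∈ ℤ`), `exists_int_natCast_mul_stabEisCuspDiff` (`N·v(m,b) ∈ ℤ` for odd `b`: `Φ ∈ ℤ` on the Bézout matrices).
* §2 `cusp8_of_sameOnC` / `sameOnC_of_cusp8` / `sameOnC_iff_cusp8` — the equivalence of the two currencies for
  `v = stabEisCuspDiff N β`, `N` odd, `β` admissible.

References: H. Rademacher, E. Grosswald, *Dedekind Sums* (1972), Ch. 4 A [RademacherGrosswald1972]; G. Stevens, *Arithmetic on Modular
Curves* (1982), §2.4–2.5 [Stevens1982]; L. Washington, GTM 83, §7.1 [Washington1997].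
-/

set_option linter.dupNamespace false
set_option autoImplicit false

noncomputable section

open scoped Classical

open Literature.NumberTheory.EllipticCurves Literature.NumberTheory.ModularForms
  Summit.BirchSwinnertonDyer.Rank1Residual.X1.MuLambda

namespace Summit.BirchSwinnertonDyer.BirchSwinnertonDyer.Theorems.DepletionAtTwo

/-! ## §1. `N·c_t ∈ ℤ` and `N·v ∈ ℤ` -/

section Integrality

variable {N : ℕ} {β : ℕ → ℕ}

/-- `ℓ · L_{ℓ,j} ∈ ℤ` for every local stabilisation coefficient (`L_{ℓ,j} ∈ {1, −β_ℓ/ℓ, −(1+ℓ)/ℓ, 1/ℓ, 0}`).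
[cite: Stevens1982, §2.4 (PDF pp. 35–37)] -/
theorem exists_int_natCast_mul_localStabCoeff (ℓ j : ℕ) : ∃ z : ℤ, (ℓ : ℚ) * localStabCoeff N β ℓ j = z := by
  unfold localStabCoeff
  rcases Nat.eq_zero_or_pos ℓ with rfl | hℓ
  · refine ⟨0, ?_⟩; simp
  have hℓ0 : (ℓ : ℚ) ≠ 0 := by exact_mod_cast hℓ.ne'
  split_ifs
  · exact ⟨ℓ, by push_cast; ring⟩
  · exact ⟨-(β ℓ : ℤ), by field_simp; push_cast; ring⟩
  · exact ⟨0, by simp⟩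
  · exact ⟨ℓ, by push_cast; ring⟩
  · exact ⟨-(1 + ℓ : ℤ), by field_simp; push_cast; ring⟩
  · exact ⟨1, by field_simp; norm_num⟩
  · exact ⟨0, by simp⟩
  · exact ⟨ℓ, by push_cast; ring⟩
  · exact ⟨0, by simp⟩

/-- `ℓ^f · L_{ℓ,j} ∈ ℤ` for `f ≥ 1`. [cite: Stevens1982, §2.4 (PDF pp. 35–37)] -/
theorem exists_int_natCast_pow_mul_localStabCoeff (ℓ j : ℕ) {f : ℕ} (hf : 1 ≤ f) :
    ∃ z : ℤ, ((ℓ : ℚ) ^ f) * localStabCoeff N β ℓ j = z := by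
  obtain ⟨z, hz⟩ := exists_int_natCast_mul_localStabCoeff (N := N) (β := β) ℓ j
  obtain ⟨f', rfl⟩ := Nat.exists_eq_add_of_le' hf
  refine ⟨(ℓ : ℤ) ^ f' * z, ?_⟩
  rw [pow_succ, mul_assoc, hz]; push_cast; ring

/-- **`N · c_t ∈ ℤ`** for `N ≠ 0` (`N = ∏_ℓ ℓ^{f_ℓ}`, `c_t = ∏_ℓ L_{ℓ, e_ℓ(t)}`, and `ℓ^{f_ℓ}·L ∈ ℤ`).
[cite: Stevens1982, §2.4 (PDF pp. 35–37)] -/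
theorem exists_int_natCast_mul_stabCoeff (hN : N ≠ 0) (t : ℕ) : ∃ z : ℤ, (N : ℚ) * stabCoeff N β t = z := by
  have hNprod : (N : ℚ) = ∏ ℓ ∈ N.primeFactors, ((ℓ : ℚ) ^ N.factorization ℓ) := by
    conv_lhs => rw [Nat.prod_primeFactors_pow_factorization hN]
    push_cast
    rfl
  unfold stabCoeff
  rw [hNprod, ← Finset.prod_mul_distrib]
  -- each factor is an integer; a finite product of integers is an integer
  have key : ∀ s : Finset ℕ, s ⊆ N.primeFactors →
      ∃ z : ℤ, ∏ ℓ ∈ s, ((ℓ : ℚ) ^ N.factorization ℓ * localStabCoeff N β ℓ (t.factorization ℓ)) = z := by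
    intro s
    induction s using Finset.induction_on with
    | empty => intro; exact ⟨1, by simp⟩
    | @insert ℓ s hℓs ih =>
      intro hsub
      obtain ⟨z, hz⟩ := ih (fun x hx ↦ hsub (Finset.mem_insert_of_mem hx))
      have hℓ : ℓ ∈ N.primeFactors := hsub (Finset.mem_insert_self ℓ s)
      have hf : 1 ≤ N.factorization ℓ := by
        have : N.factorization ℓ ≠ 0 := by
          rw [← Finsupp.mem_support_iff, Nat.support_factorization]; exact hℓ
        omega
      obtain ⟨w, hw⟩ := exists_int_natCast_pow_mul_localStabCoeff (N := N) (β := β) ℓ (t.factorization ℓ) hf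
      refine ⟨w * z, ?_⟩
      rw [Finset.prod_insert hℓs, hw, hz]; push_cast; ring
  exact key N.primeFactors (subset_refl _)

/-- **`N · v(m, b) ∈ ℤ`** for odd `N`, odd `b`: `v(m,b) = ∑_t c_t·(Φ(…b…) − Φ(…1…))` with `Φ ∈ ℤ` on the Bézout matrices
(`exists_int_rademacherPhi_gammaEntries`) and `N·c_t ∈ ℤ`. [cite: RademacherGrosswald1972, Ch. 4 A (pp. 49–50)] [cite: Stevens1982, §2.5 (PDF p. 38)] -/
theorem exists_int_natCast_mul_stabEisCuspDiff (hodd : Odd N) (m : ℕ) {b : ℤ} (hb : Odd b) :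
    ∃ z : ℤ, (N : ℚ) * stabEisCuspDiff N β m b = z := by
  have hN : N ≠ 0 := fun h ↦ by simp [h] at hodd
  rw [stabEisCuspDiff_eq, stabEisensteinPeriod_eq, stabEisensteinPeriod_eq, ← Finset.sum_sub_distrib, Finset.mul_sum]
  have key : ∀ t ∈ N.divisors, ∃ z : ℤ,
      (N : ℚ) * (stabCoeff N β t * rademacherPhi (Int.gcdA ((2 ^ m : ℕ) : ℤ) (b * N)) (t * b)
          ((-(N : ℤ) * Int.gcdB ((2 ^ m : ℕ) : ℤ) (b * N)) / t) ((2 ^ m : ℕ) : ℤ) -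
        stabCoeff N β t * rademacherPhi (Int.gcdA ((2 ^ m : ℕ) : ℤ) (1 * N)) (t * 1)
          ((-(N : ℤ) * Int.gcdB ((2 ^ m : ℕ) : ℤ) (1 * N)) / t) ((2 ^ m : ℕ) : ℤ)) = z := by
    intro t ht
    obtain ⟨c, hc⟩ := exists_int_natCast_mul_stabCoeff (β := β) hN t
    obtain ⟨z₁, hz₁⟩ := exists_int_rademacherPhi_gammaEntries hodd m hb ht
    obtain ⟨z₂, hz₂⟩ := exists_int_rademacherPhi_gammaEntries hodd m odd_one ht
    refine ⟨c * (z₁ - z₂), ?_⟩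
    rw [hz₁, hz₂, ← mul_sub, ← mul_assoc, hc]; push_cast; ring
  choose! Z hZ using key
  refine ⟨∑ t ∈ N.divisors, Z t, ?_⟩
  rw [Int.cast_sum]
  exact Finset.sum_congr rfl fun t ht ↦ hZ t ht

end Integrality

/-! ## §2. The two currencies of (★-SymbC) are equivalent -/

section Currencies

variable {N : ℕ} {β : ℕ → ℕ}

/-- `‖8‖₂ = 8⁻¹`. [folklore] -/
theorem norm_eight_padic_two : ‖(8 : ℚ_[2])‖ = 8⁻¹ := by
  rw [show (8 : ℚ_[2]) = ((2 : ℕ) : ℚ_[2]) ^ 3 by norm_num, norm_pow, Padic.norm_p]; norm_num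

/-- Integers `2`-adically within `1/2` are congruent mod `2`. [folklore] -/
theorem intCast_zmod_two_eq_of_norm_sub_le {n n' : ℤ} (h : ‖(n : ℚ_[2]) - (n' : ℚ_[2])‖ ≤ 2⁻¹) :
    (n : ZMod 2) = (n' : ZMod 2) := by
  have h' : ‖((n - n' : ℤ) : ℚ_[2])‖ ≤ ((2 : ℕ) : ℝ) ^ (-(1 : ℕ) : ℤ) := by
    push_cast; simpa using h
  have hdvd := (Padic.norm_int_le_pow_iff_dvd (n - n') 1).mp h'
  rw [pow_one] at hdvd
  have : ((2 : ℕ) : ℤ) ∣ n' - n := by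
    have : (2 : ℤ) ∣ n' - n := by rw [← neg_sub]; exact (dvd_neg).mpr (by exact_mod_cast hdvd)
    exact_mod_cast this
  exact (ZMod.intCast_eq_intCast_iff_dvd_sub n n' 2).mpr this

/-- An integer of `2`-adic norm `1` is odd. [folklore] -/
theorem odd_of_norm_intCast_eq_one {n : ℤ} (h : ‖(n : ℚ_[2])‖ = 1) : Odd n := by
  rw [← Int.not_even_iff_odd, even_iff_two_dvd]
  intro hdvd
  have : ‖(n : ℚ_[2])‖ < 1 := Padic.norm_intCast_lt_one_iff.mpr (by exact_mod_cast hdvd)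
  exact absurd h this.ne

/-- **(★-SymbC) ⇒ (★-SymbC′)**: primitive scales `(g, g')` with congruent integers mod `2` and an odd curve-side value give the
scale-`8` congruence `‖n − v(m,a)/8‖₂ ≤ 2⁻¹` with the same `g` (the Eisenstein scale is pinned: `‖g'‖₂ = 8⁻¹`,
`norm_eq_eighth_of_primitiveScale`). [cite: Washington1997, §7.1] -/
theorem cusp8_of_sameOnC (hodd : Odd N) (hadm : IsAdmissibleStabData N β) (u : ℕ → ℤ → ℚ) {g g' : ℚ}
    (hC : ∀ (m : ℕ) (a : ℤ), InC m a → ∃ n n' : ℤ, u m a = n * g ∧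
      stabEisCuspDiff N β m a = n' * g' ∧ (n : ZMod 2) = (n' : ZMod 2))
    (hwit : ∃ (m : ℕ) (a : ℤ), InC m a ∧ ∃ n : ℤ, u m a = n * g ∧ Odd n) (hg : g ≠ 0) :
    ∀ (m : ℕ) (a : ℤ), InC m a → ∃ n : ℤ, u m a = n * g ∧
      ‖(n : ℚ_[2]) - ((stabEisCuspDiff N β m a / 8 : ℚ) : ℚ_[2])‖ ≤ 2⁻¹ := by
  -- the Eisenstein side is integral and primitive in units of `g'` (oddness transfers through the congruence)
  have hint : ∀ m a, InC m a → ∃ n : ℤ, stabEisCuspDiff N β m a = n * g' := fun m a h ↦ by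
    obtain ⟨-, n', -, hv, -⟩ := hC m a h; exact ⟨n', hv⟩
  have hprim : ∃ m a, InC m a ∧ ∃ n : ℤ, stabEisCuspDiff N β m a = n * g' ∧ Odd n := by
    obtain ⟨m, a, hma, n, hu, hn⟩ := hwit
    obtain ⟨n₁, n₁', hu₁, hv₁, hc₁⟩ := hC m a hma
    have h1 : n₁ = n := by
      have h : (n₁ : ℚ) * g = n * g := hu₁.symm.trans hu
      exact_mod_cast mul_right_cancel₀ hg h
    refine ⟨m, a, hma, n₁', hv₁, ?_⟩
    have hdvd : (2 : ℤ) ∣ n₁' - n₁ := by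
      have := (ZMod.intCast_eq_intCast_iff_dvd_sub n₁ n₁' 2).mp hc₁
      exact_mod_cast this
    obtain ⟨k, hk⟩ := hdvd
    have : n₁' = n + 2 * k := by rw [← h1]; linarith
    rw [this]; exact hn.add_even (even_two_mul k)
  have hq : ‖((g' : ℚ) : ℚ_[2])‖ = 8⁻¹ := norm_eq_eighth_of_primitiveScale hodd hadm hint hprim
  -- `q = g'/8` is a `2`-adic unit, `≡ 1 (mod 2)`
  have hq1 : ‖((g' / 8 : ℚ) : ℚ_[2])‖ = 1 := by
    rw [Rat.cast_div, Rat.cast_ofNat, norm_div, hq, norm_eight_padic_two, div_self (by norm_num)]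
  have hq2 : ‖((g' / 8 : ℚ) : ℚ_[2]) - 1‖ ≤ 2⁻¹ := by
    set z : ℤ_[2] := ⟨((g' / 8 : ℚ) : ℚ_[2]), hq1.le⟩ with hz
    have hzu : IsUnit z := PadicInt.isUnit_iff.mpr (by rw [hz]; exact hq1)
    have := norm_units_sub_one_le_half hzu.unit
    rwa [hzu.unit_spec] at this
  intro m a hma
  obtain ⟨n, n', hu, hv, hc⟩ := hC m a hma
  refine ⟨n, hu, ?_⟩
  have hid : (n : ℚ_[2]) - ((stabEisCuspDiff N β m a / 8 : ℚ) : ℚ_[2]) =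
      ((n : ℚ_[2]) - n') - (n' : ℚ_[2]) * (((g' / 8 : ℚ) : ℚ_[2]) - 1) := by
    rw [hv]; push_cast; ring
  rw [hid]
  refine norm_sub_le_of_le_two (norm_intCast_sub_le_half_of_zmod_eq hc) ?_
  rw [norm_mul]
  calc ‖(n' : ℚ_[2])‖ * _ ≤ 1 * 2⁻¹ := by gcongr; exact Padic.norm_int_le_one n'
    _ = 2⁻¹ := one_mul _

/-- **(★-SymbC′) ⇒ (★-SymbC)**: the scale-`8` congruence gives primitive scales `(g, 8/N)` with congruent integers mod `2`
(`n' = N·v/8 ∈ ℤ` by `N·v ∈ ℤ` and `‖v‖₂ ≤ 8⁻¹`, `starEisEight₂`; `N ≡ 1 (mod 2)`) and an odd curve-side value (at the point where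
`‖v‖₂ = 8⁻¹`, `exists_inC_norm_stabEisCuspDiff_eq`). [cite: Washington1997, §7.1] -/
theorem sameOnC_of_cusp8 (hodd : Odd N) (hadm : IsAdmissibleStabData N β) (u : ℕ → ℤ → ℚ) {g : ℚ}
    (hC8 : ∀ (m : ℕ) (a : ℤ), InC m a → ∃ n : ℤ, u m a = n * g ∧
      ‖(n : ℚ_[2]) - ((stabEisCuspDiff N β m a / 8 : ℚ) : ℚ_[2])‖ ≤ 2⁻¹) :
    (∀ (m : ℕ) (a : ℤ), InC m a → ∃ n n' : ℤ, u m a = n * g ∧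
      stabEisCuspDiff N β m a = n' * (8 / N) ∧ (n : ZMod 2) = (n' : ZMod 2)) ∧
    (∃ (m : ℕ) (a : ℤ), InC m a ∧ ∃ n : ℤ, u m a = n * g ∧ Odd n) := by
  have hN : N ≠ 0 := fun h ↦ by simp [h] at hodd
  have hNq : (N : ℚ) ≠ 0 := by exact_mod_cast hN
  have hNnorm : ‖(N : ℚ_[2])‖ = 1 := by
    rw [show (N : ℚ_[2]) = ((N : ℤ) : ℚ_[2]) by push_cast; rfl]
    exact norm_intCast_eq_one_of_odd (by exact_mod_cast hodd)
  -- on `C`: `n' := N·v/8 ∈ ℤ`, congruent to `n` mod 2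
  have hpt : ∀ (m : ℕ) (a : ℤ), InC m a → ∀ n : ℤ,
      ‖(n : ℚ_[2]) - ((stabEisCuspDiff N β m a / 8 : ℚ) : ℚ_[2])‖ ≤ 2⁻¹ →
      ∃ n' : ℤ, stabEisCuspDiff N β m a = n' * (8 / N) ∧ (n : ZMod 2) = (n' : ZMod 2) ∧
        ‖(n' : ℚ_[2])‖ = ‖((stabEisCuspDiff N β m a : ℚ) : ℚ_[2])‖ / 8⁻¹ := by
    intro m a hma n hn
    have haodd : Odd a := by
      obtain ⟨-, h4, -, -⟩ := hma
      exact Int.odd_iff.mpr (by omega)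
    obtain ⟨z, hz⟩ := exists_int_natCast_mul_stabEisCuspDiff (β := β) hodd m haodd
    have h8 := starEisEight₂ N hodd β hadm m a hma
    -- `8 ∣ z`
    have hz8 : ‖(z : ℚ_[2])‖ ≤ ((2 : ℕ) : ℝ) ^ (-(3 : ℕ) : ℤ) := by
      have : (z : ℚ_[2]) = (N : ℚ_[2]) * ((stabEisCuspDiff N β m a : ℚ) : ℚ_[2]) := by
        rw [← Rat.cast_natCast, ← Rat.cast_mul, hz]; push_cast; rfl
      rw [this, norm_mul, hNnorm, one_mul, show ((2 : ℕ) : ℝ) ^ (-(3 : ℕ) : ℤ) = 8⁻¹ by norm_num]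
      exact h8
    obtain ⟨n', hn'⟩ := (Padic.norm_int_le_pow_iff_dvd z 3).mp hz8
    have hn'q : (z : ℚ) = 8 * n' := by exact_mod_cast hn'
    have hv : stabEisCuspDiff N β m a = n' * (8 / N) := by
      field_simp
      linear_combination hz + hn'q
    refine ⟨n', hv, ?_, ?_⟩
    · -- `n − n' = (n − v/8) − n'·(1 − N)/N`, both of norm `≤ 1/2`
      apply intCast_zmod_two_eq_of_norm_sub_le
      have hid : (n : ℚ_[2]) - (n' : ℚ_[2]) =
          ((n : ℚ_[2]) - ((stabEisCuspDiff N β m a / 8 : ℚ) : ℚ_[2])) +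
            (n' : ℚ_[2]) * ((((1 : ℚ) - N) / N : ℚ) : ℚ_[2]) := by
        rw [hv]; push_cast; field_simp; ring
      rw [hid]
      refine norm_add_le_of_le_two hn ?_
      rw [norm_mul]
      have h1N : ‖((((1 : ℚ) - N) / N : ℚ) : ℚ_[2])‖ ≤ 2⁻¹ := by
        obtain ⟨k, hk⟩ := hodd
        rw [Rat.cast_div, norm_div, Rat.cast_natCast, hNnorm, div_one,
          show (((1 : ℚ) - N : ℚ) : ℚ_[2]) = ((-k : ℤ) : ℚ_[2]) * 2 by rw [hk]; push_cast; ring, norm_mul,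
          TwoAdicTwistConverse.norm_two_padic_two]
        calc ‖((-k : ℤ) : ℚ_[2])‖ * (2 : ℝ)⁻¹ ≤ 1 * 2⁻¹ := by gcongr; exact Padic.norm_int_le_one _
          _ = 2⁻¹ := one_mul _
      calc ‖(n' : ℚ_[2])‖ * _ ≤ 1 * 2⁻¹ := by gcongr; exact Padic.norm_int_le_one n'
        _ = 2⁻¹ := one_mul _
    · rw [hv, Rat.cast_mul, Rat.cast_intCast, Rat.cast_div, Rat.cast_ofNat, Rat.cast_natCast, norm_mul, norm_div,
        norm_eight_padic_two, hNnorm, div_one, mul_div_assoc, div_self (by norm_num), mul_one]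
  refine ⟨fun m a hma ↦ ?_, ?_⟩
  · obtain ⟨n, hu, hn⟩ := hC8 m a hma
    obtain ⟨n', hv, hc, -⟩ := hpt m a hma n hn
    exact ⟨n, n', hu, hv, hc⟩
  · obtain ⟨m, a, hma, hv8⟩ := exists_inC_norm_stabEisCuspDiff_eq hodd hadm
    obtain ⟨n, hu, hn⟩ := hC8 m a hma
    obtain ⟨n', -, hc, hnorm⟩ := hpt m a hma n hn
    refine ⟨m, a, hma, n, hu, ?_⟩
    have hn'odd : Odd n' := odd_of_norm_intCast_eq_one (by rw [hnorm, hv8, div_self (by norm_num)])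
    -- `n ≡ n' (mod 2)` and `n'` odd
    have hdvd : (2 : ℤ) ∣ n' - n := by
      have := (ZMod.intCast_eq_intCast_iff_dvd_sub n n' 2).mp hc
      exact_mod_cast this
    obtain ⟨k, hk⟩ := hdvd
    have : n = n' + 2 * (-k) := by linarith
    rw [this]; exact hn'odd.add_even (even_two_mul _)

/-- **The two currencies of (★-SymbC) are equivalent** (for odd `N`, admissible `β`, any curve-side function `u`):
`SameOnCModTwo u v` — scales `g, g' ≠ 0` with `u/g, v/g' ∈ ℤ` congruent mod `2` on `C` and `u/g` odd somewhere on `C` — holds iff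
some `g ≠ 0` makes `u/g ∈ ℤ` on `C` with `‖u/g − v/8‖₂ ≤ 2⁻¹`. [cite: Washington1997, §7.1] -/
theorem sameOnC_iff_cusp8 (hodd : Odd N) (hadm : IsAdmissibleStabData N β) (u : ℕ → ℤ → ℚ) :
    (∃ g g' : ℚ, g ≠ 0 ∧ g' ≠ 0 ∧
      (∀ (m : ℕ) (a : ℤ), InC m a → ∃ n n' : ℤ, u m a = n * g ∧
        stabEisCuspDiff N β m a = n' * g' ∧ (n : ZMod 2) = (n' : ZMod 2)) ∧
      (∃ (m : ℕ) (a : ℤ), InC m a ∧ ∃ n : ℤ, u m a = n * g ∧ Odd n)) ↔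
    (∃ g : ℚ, g ≠ 0 ∧ ∀ (m : ℕ) (a : ℤ), InC m a → ∃ n : ℤ, u m a = n * g ∧
      ‖(n : ℚ_[2]) - ((stabEisCuspDiff N β m a / 8 : ℚ) : ℚ_[2])‖ ≤ 2⁻¹) := by
  constructor
  · rintro ⟨g, g', hg, -, hC, hwit⟩
    exact ⟨g, hg, cusp8_of_sameOnC hodd hadm u hC hwit hg⟩
  · rintro ⟨g, hg, hC8⟩
    have hN : (N : ℚ) ≠ 0 := by
      have : N ≠ 0 := fun h ↦ by simp [h] at hodd
      exact_mod_cast this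
    obtain ⟨hC, hwit⟩ := sameOnC_of_cusp8 hodd hadm u hC8
    exact ⟨g, 8 / N, hg, div_ne_zero (by norm_num) hN, hC, hwit⟩

end Currencies

end Summit.BirchSwinnertonDyer.BirchSwinnertonDyer.Theorems.DepletionAtTwo

end
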